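import Summits.HodgeConjecture.HodgeConjecture.Theorems.MarkmanPartnerTransportPicardThreeK3SquaresRMTypeOpenSubtypeByName
import Summits.HodgeConjecture.HodgeConjecture.Theorems.MarkmanPartnerTransportPicardThreeK3SquaresZeta11TypeOfConj
import HarnessLib

/-!
# Route MarkmanPartnerTransport · crux `PicardThreeK3Squares` (stmt-HodgeConjecture-19652) —
# HC⁴(S ⊗ S) for the SUB-TYPES of the ζ₁₁ real-multiplication type (quintic RM by `ℚ(ζ₁₁ + ζ₁₁⁻¹)`,
# Picard number 7 — the terminal type (7,5,3) — included), from the cycle on every member of the maximal family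

Cell hodge-nonav, crux #4 (HC⁴(S ⊗ S), ρ(S) ≥ 3; open core: real multiplication), programme «RATIONAL ORBIT
DENSITY» continued (prover seat hodge-nonav-19652-p1 gen 20; `--supports stmt-HodgeConjecture-19652`,
helper). CONDITIONAL on the named fact `Buskin2019_hodgeIsometry_algebraic` and a DISPLAYED strong open input
(the ∀-MEMBER form of the van Geemen–Schütt ∕ Oguiso–Zhang ζ₁₁ open-period-set fact, proposed separately under
`Literature/AlgebraicGeometry/Surfaces/K3RealMultiplicationZeta11OpenFamily`); credits nothing; nothing here
says HC is proved; rung F-H1 not moved.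

THE POINT. `hodgeConjectureFor_square_of_zeta11Type` (gen 11) settles BY NAME the K3 squares of the ζ₁₁
rational real-multiplication type — generator conjugate to the model `θ_ℂ` on ALL of `H²`, hence Picard
number `2` (`…Zeta11TypeOfConj`), cell (3,5) of crux #5 through `X = S^{[2]}`. The ζ₁₁ Hodge locus also
carries Noether–Lefschetz-SPECIAL K3 surfaces of Picard number `7` — `T(S)_ℚ` an `F`-subspace of `F`-rank `3`
of the model's rank-`4` space `U^⊥ ⊗ ℚ`, `F = ℚ(ζ₁₁ + ζ₁₁⁻¹)`, generator conjugate to `θ` on `T(S)` ONLY —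
i.e. surfaces of the TERMINAL type `(7,5,3)` of the cell's Noether–Lefschetz ascent (memo NL-ASCENT gen 18),
INSIDE crux #4's open Picard list. By the sub-type descent (T⁗) (`…RMTypeOpenSubtype{,ByName}`: orbit
density + Buskin transport + NS-absorption) they are reached by the same mechanism provided the family's
cycle is available at every member over the open period set — which van Geemen–Schütt's construction gives.
This file derives, with the strong input DISPLAYED (`OpenAll[θ, e₀]`; the by-name corollary consuming the
∀-member fact follows in a companion once that fact is in the Literature layer):

* `aeval_X_mul_sextic_eq_zero_of_zeta11Model` — the model identity `θ_ℂ·Q₁₁(θ_ℂ) = 0`, `Q₁₁ = (X - 2)·P₁₁`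
  (from `piU_mul_thetaC` and `aeval_thetaC_sextic_apply_of_piU_eq_zero`);
  `isAnnihilatedOnTranscendentalBy_sextic_of_quintic` (`P₁₁(t) = 0` on `T` ⇒ `Q₁₁(t) = 0` on `T`).
* `hodgeConjectureFor_square_of_zeta11Model_of_openAll` — (T⁗) for a ζ₁₁ datum GIVEN the strong open input
  (reusable ∀-datum form, mod Buskin only).
  WHICH SURFACES (Witt over `ℚ`, not formalised): every marked projective K3 surface with an endomorphism `t`
  (rational, type-preserving, killing `N¹`, `P₁₁(t) = 0` on `T(S)`, generating `End_Hdg T(S)`) conjugate to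
  `θ_ℂ` ON `T(S)` by a rational isometry of `Λ_ℚ` — i.e. every K3 surface with real multiplication by
  `F = ℚ(ζ₁₁ + ζ₁₁⁻¹)` whose `F`-quadratic space `(T(S)_ℚ, Φ_S)` is represented by the ζ₁₁ model's `U^⊥ ⊗ ℚ`:
  Picard number `2` (the type itself) or `7` (a CONDITION on the ternary `F`-form — Hasse–Minkowski over `F`;
  the first kernel content at the terminal type `(7,5,3)`).

No definition, no sorry, no new named fact. References: van
Geemen–Schütt, Forum Math. Sigma 13 (2025) e2, Thm. 1.1 (11), §2.6, §3.4, §4.5–4.8, §5.8, §6.6;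
Oguiso–Zhang, Pure Appl. Math. Q. 7 (2011), Thm. 1.5; Buskin, J. reine angew. Math. 755 (2019), Thm. 1.1;
van Geemen, Michigan Math. J. 56 (2008) Lemma 3.2; O'Meara, *Introduction to Quadratic Forms*, 63:21, 66:3.
-/

set_option linter.dupNamespace false

noncomputable section

namespace Summit.HodgeConjecture.HodgeConjecture.Theorems.MarkmanPartnerTransport.RMTypeOrbit

open CategoryTheory MonoidalCategory Polynomial
open Literature.AlgebraicGeometry Literature.AlgebraicGeometry.Motives Literature.AlgebraicGeometry.HodgeTheory
open Literature.AlgebraicGeometry.Surfaces Literature.LinearAlgebra.QuadraticForm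
open Literature.AlgebraicTopology.SingularHomology
open Summit.HodgeConjecture.HodgeConjecture.Theorems.NikulinTwinTransport
open Summit.HodgeConjecture.HodgeConjecture.Theorems.MarkmanPartnerTransport.IsogenyInvariance
open Summit.HodgeConjecture.HodgeConjecture.Theorems.MarkmanPartnerTransport.RMTypeDescent

/-- `MarkedK3[S, η, p, x]`: VERBATIM the `let MarkedK3 := …` binder of the route declaration
`PicardThreeK3Squares` (as in `…RMTypeDescent`). Local notation only. -/
local notation3 (prettyPrint := false) "MarkedK3[" S ", " η ", " p ", " x "]" =>
  (p ≠ 0 ∧ (IsIntegralClass p ∧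
    (∀ q : complexBetti S (2 * 2), IsIntegralClass q → ∃ n : ℤ, q = n • p) ∧
    (∀ c : complexBetti S (2 * 1), IsIntegralClass c ↔ ∃ v : K3Index → ℤ, η c = fun i => (v i : ℂ)) ∧
    (∀ a b : complexBetti S (2 * 1),
      cupProduct (rfl : 2 * 1 + 2 * 1 = 2 * 2) a b = k3Form (η a) (η b) • p) ∧
    IsOfHodgeType 2 S (2 * 1) 2 0 (LinearEquiv.symm η x) ∧
    (∀ τ : complexBetti S (2 * 1), IsOfHodgeType 2 S (2 * 1) 2 0 τ →
      ∃ t : ℂ, τ = t • LinearEquiv.symm η x)) ∧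
    (k3Form x x = 0 ∧ 0 < (k3Form (star x) x).re ∧
      ∃ u : K3Index → ℤ, k3Form (fun i => (u i : ℂ)) x = 0 ∧ 0 < ∑ i, ∑ j, u i * k3Gram i j * u j))

variable {S : SchemeOver ℂ}

/-- `CycleAll[θ, e, U]`: the STRONG ∃-form open-set input — at EVERY period point of `D_{θ,e}` in `U`
(`θ`-generic OR NOT) there is a marked projective K3 surface carrying an algebraic class inducing
`η'⁻¹ θ_ℂ η'`. (`CycleEx[θ, e, U]` of `…RMTypeOpenExists` is the same clause restricted to `θ`-generic
periods.) Local notation only. -/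
local notation3 (prettyPrint := false) "CycleAll[" θ ", " e ", " U "]" =>
  (∀ y : K3Index → ℂ, y ∈ U → thetaC θ y = (e : ℂ) • y → k3Form y y = 0 → 0 < (k3Form (star y) y).re →
    ∃ (S' : SchemeOver ℂ) (hS' : IsK3Surface S') (η' : complexBetti S' (2 * 1) ≃ₗ[ℂ] (K3Index → ℂ))
      (p' : complexBetti S' (2 * 2)), MarkedK3[S', η', p', y] ∧
      ∃ γ' ∈ algebraicClasses (S' ⊗ S') 2, ∀ z : complexBetti S' (2 * 1),
        (η'.symm.toLinearMap ∘ₗ (thetaC θ ∘ₗ η'.toLinearMap)) z =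
          complexGysin complexOrientationFamily
            (IsSmoothProjective.tensor_holds hS'.isSmoothProjective hS'.isSmoothProjective)
            hS'.isSmoothProjective (SemiCartesianMonoidalCategory.fst S' S')
            (rfl : 2 * 1 + 2 * 2 + 2 * 2 = 2 * 1 + 2 * (2 + 2))
            (cupProduct (rfl : 2 * 1 + 2 * 2 = 2 * 1 + 2 * 2)
              (complexBetti.map (SemiCartesianMonoidalCategory.snd S' S') (2 * 1) z) γ'))

/-- `OpenAll[θ, e]`: there is an open `U ⊂ Λ_ℂ` containing a `θ`-GENERIC period point of `D_{θ,e}` on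
which `CycleAll[θ, e, U]` holds. Local notation only. -/
local notation3 (prettyPrint := false) "OpenAll[" θ ", " e "]" =>
  (∃ U : Set (K3Index → ℂ), IsOpen U ∧
    (∃ y₁ ∈ U, thetaC θ y₁ = (e : ℂ) • y₁ ∧ k3Form y₁ y₁ = 0 ∧ 0 < (k3Form (star y₁) y₁).re ∧
      ∀ v : K3Index → ℚ, k3Form (fun i => (v i : ℂ)) y₁ = 0 → Matrix.mulVec θ v = 0) ∧
    CycleAll[θ, e, U])

/-- `Zeta11Model[g, u₁, u₂, y₀, θ]`: VERBATIM the antecedents of the named fact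
`VanGeemenSchuett2025_OguisoZhang2011_zeta11_cycleOnOpenPeriodSet` (as in `…PicardThreeK3SquaresZeta11Type`).
Local notation only. -/
local notation3 (prettyPrint := false) "Zeta11Model[" g ", " u₁ ", " u₂ ", " y₀ ", " θ "]" =>
  ((∀ a b : K3Index → ℂ, k3Form (g a) (g b) = k3Form a b) ∧
    (∀ v : K3Index → ℤ, ∃ w : K3Index → ℤ,
      g (fun i => ((v i : ℤ) : ℂ)) = fun i => ((w i : ℤ) : ℂ)) ∧
    g ^ 11 = 1 ∧
    g (fun i => ((u₁ i : ℤ) : ℂ)) = (fun i => ((u₁ i : ℤ) : ℂ)) ∧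
    g (fun i => ((u₂ i : ℤ) : ℂ)) = (fun i => ((u₂ i : ℤ) : ℂ)) ∧
    k3Form (fun i => ((u₁ i : ℤ) : ℂ)) (fun i => ((u₁ i : ℤ) : ℂ)) = 0 ∧
    k3Form (fun i => ((u₂ i : ℤ) : ℂ)) (fun i => ((u₂ i : ℤ) : ℂ)) = 0 ∧
    k3Form (fun i => ((u₁ i : ℤ) : ℂ)) (fun i => ((u₂ i : ℤ) : ℂ)) = 1 ∧
    (∀ v : K3Index → ℤ, g (fun i => ((v i : ℤ) : ℂ)) = (fun i => ((v i : ℤ) : ℂ)) →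
      ∃ m n : ℤ, v = m • u₁ + n • u₂) ∧
    k3Form y₀ y₀ = 0 ∧ 0 < (k3Form (star y₀) y₀).re ∧
    g y₀ = Complex.exp (2 * Real.pi * Complex.I / 11) • y₀ ∧
    (∀ y : K3Index → ℂ, thetaC θ y =
      g y + (g ^ 10) y - (2 * k3Form y (fun i => ((u₂ i : ℤ) : ℂ))) • (fun i => ((u₁ i : ℤ) : ℂ))
        - (2 * k3Form y (fun i => ((u₁ i : ℤ) : ℂ))) • (fun i => ((u₂ i : ℤ) : ℂ))))

/-- `πU[u₁, u₂]`: the `k3Form`-orthogonal projector `y ↦ (y.u₂)u₁ + (y.u₁)u₂` onto the hyperbolic plane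
`ℂu₁ ⊕ ℂu₂` (for `(u₁.u₁) = (u₂.u₂) = 0`, `(u₁.u₂) = 1`). Local notation only. -/
local notation3 (prettyPrint := false) "πU[" u₁ ", " u₂ "]" =>
  ((LinearMap.smulRight (k3FormC (fun i : K3Index => ((u₂ i : ℤ) : ℂ))) (fun i : K3Index => ((u₁ i : ℤ) : ℂ)) +
      LinearMap.smulRight (k3FormC (fun i : K3Index => ((u₁ i : ℤ) : ℂ))) (fun i : K3Index => ((u₂ i : ℤ) : ℂ)) :
    Module.End ℂ (K3Index → ℂ)))

/-- `Q₁₁ = (X - 2)(X⁵ + X⁴ - 4X³ - 3X² + 3X + 1) ∈ ℚ[X]`: `X - 2` times the minimal polynomial of `ζ₁₁ + ζ₁₁⁻¹`.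
Local notation only. -/
local notation3 (prettyPrint := false) "Q₁₁" =>
  ((X - C (2 : ℚ)) * (X ^ 5 + X ^ 4 - C (4 : ℚ) * X ^ 3 - C (3 : ℚ) * X ^ 2 + C (3 : ℚ) * X + 1) : ℚ[X])

/-- The quintic `P₁₁ = X⁵ + X⁴ - 4X³ - 3X² + 3X + 1 ∈ ℚ[X]` (minimal polynomial of `2cos(2π/11)`).
Local notation only. -/
local notation3 (prettyPrint := false) "P₁₁" =>
  (X ^ 5 + X ^ 4 - C (4 : ℚ) * X ^ 3 - C (3 : ℚ) * X ^ 2 + C (3 : ℚ) * X + 1 : ℚ[X])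

/-- `SubSquareHC₁₁[θ]`: **HC⁴(S ⊗ S) for every marked projective K3 surface whose endomorphism `t`
(rational, type-preserving, killing `N¹`, annihilated on `T(S)` by `P₁₁`, generating `End_Hdg T(S)`) is
conjugate to `θ_ℂ` ON THE TRANSCENDENTAL CLASSES by a rational isometry `σ` of `Λ_ℚ`** — the sub-types of
`θ` (Noether–Lefschetz-special surfaces included). Local notation only. -/
local notation3 (prettyPrint := false) "SubSquareHC₁₁[" θ "]" =>
  (∀ (S : SchemeOver ℂ) (hS : IsK3Surface S)
    (η : complexBetti S (2 * 1) ≃ₗ[ℂ] (K3Index → ℂ)) (p : complexBetti S (2 * 2)) (x : K3Index → ℂ)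
    (_hM : MarkedK3[S, η, p, x])
    (t : complexBetti S (2 * 1) →ₗ[ℂ] complexBetti S (2 * 1))
    (_ht_rat : ∀ y, IsRationalClass y → IsRationalClass (t y))
    (_ht_typ : ∀ (i j : ℕ) (y : complexBetti S (2 * 1)),
      IsOfHodgeType 2 S (2 * 1) i j y → IsOfHodgeType 2 S (2 * 1) i j (t y))
    (_ht_N : ∀ d ∈ algebraicClasses S 1, t d = 0)
    (_hP : IsAnnihilatedOnTranscendentalBy S t P₁₁) (_hgen : TranscendentalEndomorphismsGeneratedBy S t)
    (σ : Module.End ℂ (K3Index → ℂ)) (_hσ : ∀ a b, k3Form (σ a) (σ b) = k3Form a b)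
    (_hσrat : ∀ v : K3Index → ℤ, ∃ w : K3Index → ℚ, σ (fun i => (v i : ℂ)) = fun i => (w i : ℂ))
    (_hconj : ∀ c : complexBetti S (2 * 1),
      (∀ d ∈ algebraicClasses S 1, cupProduct (rfl : 2 * 1 + 2 * 1 = 2 * 2) c d = 0) →
        σ (η (t c)) = thetaC θ (σ (η c))),
    HodgeConjectureFor 4 (S ⊗ S))

variable {g : Module.End ℂ (K3Index → ℂ)} {u₁ u₂ : K3Index → ℤ} {y₀ : K3Index → ℂ}
  {θ : Matrix K3Index K3Index ℚ} {S : SchemeOver ℂ}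

/-! ### The model identity and the annihilating sextic -/

/-- **`θ_ℂ · Q₁₁(θ_ℂ) = 0` on `Λ_ℂ`** for a ζ₁₁ datum (`Q₁₁ = (X - 2)·P₁₁`) — the model hypothesis of
`hodgeConjectureFor_square_of_openAll_of_transc_of_separable`: `θ_ℂ` has image in `ker π_U = U^⊥`
(`piU_mul_thetaC`), where `Q₁₁(θ_ℂ)` vanishes (`aeval_thetaC_sextic_apply_of_piU_eq_zero`).
[cite: GeemenSchutt2023, Thm. 1.1 (11) and §2.1] -/
theorem aeval_X_mul_sextic_eq_zero_of_zeta11Model (hZ : Zeta11Model[g, u₁, u₂, y₀, θ]) :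
    aeval (thetaC θ) (X * (Q₁₁).map (algebraMap ℚ ℂ)) = 0 := by
  refine LinearMap.ext fun v => ?_
  have hπ : πU[u₁, u₂] (thetaC θ v) = 0 := by
    rw [← Module.End.mul_apply, piU_mul_thetaC hZ, LinearMap.zero_apply]
  rw [mul_comm, map_mul, aeval_X, Module.End.mul_apply, LinearMap.zero_apply]
  exact aeval_thetaC_sextic_apply_of_piU_eq_zero hZ hπ

/-- `P₁₁(t) = 0` on `T(S)` implies `Q₁₁(t) = ((t - 2) ∘ P₁₁(t)) = 0` on `T(S)`. [folklore] -/
theorem isAnnihilatedOnTranscendentalBy_sextic_of_quintic {t : complexBetti S (2 * 1) →ₗ[ℂ] complexBetti S (2 * 1)}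
    (hP : IsAnnihilatedOnTranscendentalBy S t P₁₁) : IsAnnihilatedOnTranscendentalBy S t Q₁₁ := by
  intro y hy
  rw [Polynomial.map_mul, map_mul, Module.End.mul_apply, hP y hy, map_zero]

/-! ### (T⁗) for a ζ₁₁ datum -/

/-- **(T⁗) for a ζ₁₁ datum, GIVEN the strong open input.** Let `(g, u₁, u₂, y₀, θ)` be a ζ₁₁ datum and
suppose `θ` is cycle-induced at EVERY period of an open `U ⊂ Λ_ℂ` meeting the Hodge locus `D_{θ,e₀}`,
`e₀ = 2cos(2π/11)`, in a `θ`-generic point (`OpenAll[θ, e₀]`). Then every marked projective K3 surface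
`(S, η, p, x)` with an endomorphism `t` (rational, type-preserving, killing `N¹`, `P₁₁(t) = 0` on `T(S)`,
generating `End_Hdg T(S)`) conjugate to `θ_ℂ` ON `T(S)` by a rational isometry `σ` of `Λ_ℚ` satisfies
`HodgeConjectureFor 4 (S ⊗ S)`: `θ` is self-adjoint (`thetaC_selfAdjoint_of_zeta11Model`), `e₀ ≠ 0`,
`Q₁₁` is separable with `Q₁₁(0) ≠ 0`, `θ·Q₁₁(θ) = 0` (`aeval_X_mul_sextic_eq_zero_of_zeta11Model`), and
`hodgeConjectureFor_square_of_openAll_of_transc_of_separable` concludes. Unlike (T‴)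
(`hodgeConjectureFor_square_of_zeta11Type`) the surface need NOT be `θ`-generic: its transcendental
lattice may be a proper `θ`-stable sublattice of the model's (`ρ(S) = 7`, type `(7,5,3)` of the cell's
NL-ascent). CONDITIONAL on `Buskin2019_hodgeIsometry_algebraic` and the displayed input only; credits nothing.
[cite: GeemenSchutt2023, Thm. 1.1 (11), §2.1, §3.4, §4.8 and §6.6] [cite: Buskin2019, Thm. 1.1]
[cite: OguisoZhang2011K3Order11, Thm. 1.5 (3)] [cite: Huybrechts2016K3, Ch. 6 Prop. 1.5 and Ch. 14 §0.3 (vi)] -/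
theorem hodgeConjectureFor_square_of_zeta11Model_of_openAll
    (hB : Buskin2019_hodgeIsometry_algebraic) (hZ : Zeta11Model[g, u₁, u₂, y₀, θ])
    (hOpen : OpenAll[θ, (2 * Real.cos (2 * Real.pi / 11) : ℝ)]) : SubSquareHC₁₁[θ] := by
  intro S hS η p x hM t ht_rat ht_typ ht_N hP hgen σ hσ hσrat hconj
  have he₀ : (2 * Real.cos (2 * Real.pi / 11)) ≠ 0 := two_mul_cos_two_pi_div_eleven_pos.ne'
  exact hodgeConjectureFor_square_of_openAll_of_transc_of_separable hB (thetaC_selfAdjoint_of_zeta11Model hZ)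
    he₀ sextic_separable sextic_eval_zero_ne (aeval_X_mul_sextic_eq_zero_of_zeta11Model hZ) hOpen hS η p x
    hM t ht_rat ht_typ ht_N (isAnnihilatedOnTranscendentalBy_sextic_of_quintic hP) hgen σ hσ hσrat hconj

end Summit.HodgeConjecture.HodgeConjecture.Theorems.MarkmanPartnerTransport.RMTypeOrbit

end
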